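import Mathlib
import Summits.NavierStokesRegularity.NavierStokesRegularity.Theorems.EulerZoomLiouvillePowerGaugeEulerLiouvilleCondenserInfiniteTypePast
import Summits.NavierStokesRegularity.NavierStokesRegularity.Theorems.EulerZoomLiouvillePowerGaugeEulerLiouvilleSelfSimilarPastWeightedGradient

/-!
# Finite-type-gradient kill for a member exact up to its blow-up time (T-M, unconditional case)

Sub-problem `NavierStokesRegularity`, crux `PowerGaugeEulerLiouville` (a crux CLASS of self-similar Euler/NS strata — not NS
regularity).  `Condenser.selfSimilar_ae_eq_zero_of_finiteTypeGradientC2_past_of_weight` with its weighted-dissipation hypothesis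
`hEw` DISCHARGED by `Past.exists_lintegral_weightedGradient_le_of_blowup` in the case `T₁ = T` (the member is exactly self-similar
about `(T, x₀)` for every `τ < T`, `T ≤ 0`).  For `T₁ < T` the hypothesis `hEw` is not a consequence of the class gauges.
-/

noncomputable section

open Set Filter Topology Metric Function MeasureTheory Real
open scoped RealInnerProductSpace NNReal ENNReal

set_option linter.dupNamespace false

namespace Summit.NavierStokesRegularity.NavierStokesRegularity.Theorems.PowerGaugeEulerLiouville.Condenser

open Literature.Analysis Literature.Analysis.FluidPDE
open Summit.NavierStokesRegularity.NavierStokesRegularity.Theorems.PowerGaugeEulerLiouville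

/-- **MEMBER EXACT UP TO ITS BLOW-UP TIME WITH FINITE-TYPE `C²` PROFILE IS TRIVIAL (T-M, unconditional for `T₁ = T`).**  Crux
hypotheses verbatim (`0 < ρ ≤ ½`) + exact self-similarity about `(T, x₀)` for all `τ < T` (`T ≤ 0`) + `V ∈ C²` + finite type
`‖DV‖ ≤ exp(C R^{2+ρ})` on `B_{3R}` for an unbounded set of `R` ⇒ `u = 0` a.e. on `(−∞,0) × ℝ³`. [folklore] -/
theorem selfSimilar_ae_eq_zero_of_finiteTypeGradientC2_blowup {ρ T : ℝ} (hρ : 0 < ρ) (hρ1 : ρ ≤ 1 / 2)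
    (hT : T ≤ 0) (x₀ : EuclideanSpace ℝ (Fin 3))
    {u : ℝ → EuclideanSpace ℝ (Fin 3) → EuclideanSpace ℝ (Fin 3)} {p : ℝ → EuclideanSpace ℝ (Fin 3) → ℝ}
    {H : ℝ → EuclideanSpace ℝ (Fin 3) → EuclideanSpace ℝ (Fin 3) →L[ℝ] EuclideanSpace ℝ (Fin 3)} {c : ℝ≥0}
    (hsw : IsSuitableWeakSolutionOn (slab (EuclideanSpace ℝ (Fin 3)) (Iio 0) isOpen_Iio) 0 0 u p)
    (hH : HasWeakSpatialGradientOn (slab (EuclideanSpace ℝ (Fin 3)) (Iio 0) isOpen_Iio) u H)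
    (hgauge : ∀ a : ℝ, 0 < a →
      ENNReal.ofReal (a ^ (2 * ρ)) * cknA a (0 : ℝ × EuclideanSpace ℝ (Fin 3)) u +
          ENNReal.ofReal (a ^ ρ) * cknE a (0 : ℝ × EuclideanSpace ℝ (Fin 3)) H +
        ENNReal.ofReal (a ^ (2 * ρ)) * cknD a (0 : ℝ × EuclideanSpace ℝ (Fin 3)) p ≤ (c : ℝ≥0∞))
    {V : EuclideanSpace ℝ (Fin 3) → EuclideanSpace ℝ (Fin 3)} {P : EuclideanSpace ℝ (Fin 3) → ℝ}
    (hu : ∀ τ : ℝ, τ < T → u τ = fun x => selfSimilarCollapse (1 / (2 + ρ)) T V τ (x - x₀))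
    (hp : ∀ τ : ℝ, τ < T → p τ = fun x => selfSimilarCollapsePressure (1 / (2 + ρ)) T P τ (x - x₀))
    (hV : ContDiff ℝ 2 V)
    (hgrad : ∃ C : ℝ, ∀ R₀ : ℝ, ∃ R : ℝ, R₀ ≤ R ∧
      ∀ z ∈ ball (0 : EuclideanSpace ℝ (Fin 3)) (3 * R), ‖fderiv ℝ V z‖ ≤ Real.exp (C * R ^ (2 + ρ))) :
    uncurry u =ᵐ[volume.restrict (Iio (0 : ℝ) ×ˢ (univ : Set (EuclideanSpace ℝ (Fin 3))))] 0 := by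
  have hρ1' : ρ < 1 := by linarith
  have hE : ∀ a : ℝ, 0 < a → ENNReal.ofReal (a ^ ρ) *
      cknE a (0 : ℝ × EuclideanSpace ℝ (Fin 3)) H ≤ (c : ℝ≥0∞) :=
    fun a ha => le_trans (le_trans le_add_self le_self_add) (hgauge a ha)
  obtain ⟨E, hEw⟩ :=
    Past.exists_lintegral_weightedGradient_le_of_blowup hρ hρ1' hT x₀ hH hu hE (hV.of_le (by norm_num))
  exact selfSimilar_ae_eq_zero_of_finiteTypeGradientC2_past_of_weight hρ hρ1 hT le_rfl x₀ hsw hH hgauge hu hp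
    hV hEw hgrad

end Summit.NavierStokesRegularity.NavierStokesRegularity.Theorems.PowerGaugeEulerLiouville.Condenser

end
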